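import Summits.Ventures.YMGap.RobustBall.BoundaryFreeEnergyDim
import Summits.Ventures.YMGap.RobustBall.BoundaryRelativeEntropy
import Summits.Ventures.YMGap.RobustBall.WilsonOneStateSymmetry
import HarnessLib

/-!
# Venture YMGap, track ROBUST-BALL — «C-DS-I» VAN HOVE FORMS FOR EVERY `SU(N)` AND EVERY `d ≥ 2`: free energy, mean energy and entropy per
# plaquette of a finite region with an ARBITRARY boundary field, arbitrary shapes, on the 't Hooft single-link window

HONEST FRAMING. WHAT THIS IS: a venture file (cell `pub-ymgap`, track Y2 ROBUST-BALL / DS, seat ds-3, theorems only, 0 compute): the every-`N`,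
every-`d` twins of `BoundaryFreeEnergyVanHove` (which is `SU(2)`, `d = 4`, star window). Window: `0 ≤ β ≤ 1/(12(d−1))`, `β < 1/(8d)`, tree coupling
`Nβ`, ratio `r = max(ρ,½)` with `6(d−1)β/(½ − 2(d−1)β) ≤ ρ < 1`; `C_N = 32N⁴√N`; depths `D_p ≤ ‖y − z‖_∞` for every link `y` of `p` and every link
`z ∉ Λ`; depth budget `K`; `#planes(d) = d(d−1)/2`; `μ` THE DLR state at `Nβ` (unique, translation invariant, axis symmetric on the window —
`WilsonOneStateSymmetry.suN_wilson_oneState_symmetric_sharp`), `u = μ(Re tr U_{p₀})`.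
* `surface_sum_le_of_depth_dim` — `Σ_{p∈T} min (2N) (C·r^{⌊D_p⌋}) ≤ C·r^K·#T + 2N·#{p ∈ T : D_p < K}` (`0 ≤ r ≤ 1`, `0 ≤ C`);
* ★★ `suN_abs_log_normaliser_div_sub_le_of_depth_dim` — FREE ENERGY: `|log Z_Λ(Nβ|η)/#T(Λ) − f(Nβ)/#planes(d)| ≤ Nβ·(C_N r^K + 2N·#shallow_K/#T(Λ))`;
* ★★ `suN_abs_kernel_energy_div_sub_le_of_depth_dim` — MEAN ENERGY: `|γ_Λ^{Nβ}(S_Λ|η)/#T(Λ) − (N − u)| ≤ C_N r^K + 2N·#shallow_K/#T(Λ)`;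
* ★★ `suN_abs_klDiv_div_sub_le_of_depth_dim` — ENTROPY: `|KL(π_Λ^{Nβ,η} ‖ Haar_Λ)/#T(Λ) − (−Nβ(N − u) − f(Nβ)/#planes(d))| ≤ 2Nβ·(C_N r^K + 2N·#shallow_K/#T(Λ))`;
all HYPOTHESIS-FREE, for every finite `Λ` with `T(Λ) ≠ ∅` and EVERY boundary field `η`; hence, along every VAN HOVE SEQUENCE WITH DEPTH DATA
(shallow fractions `→ 0` for every `K`), the three densities converge UNIFORMLY IN THE BOUNDARY FIELD, for every `N ≥ 2` and `d ≥ 2`: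
★★ `suN_log_normaliser_div_vanHove_uniform_dim`, `suN_kernel_energy_div_vanHove_uniform_dim`, `suN_klDiv_div_vanHove_uniform_dim`
(`∀ ε > 0, ∃ n₀, ∀ n ≥ n₀, ∀ η, |density_n(η) − limit| ≤ ε`).
WHAT THIS IS NOT: lattice strong coupling on the single-link window (the `SU(2)`, `d = 4` star-window versions reach `β_W ≤ 9/25`); nothing about
the continuum limit or Clay. Everything here is proved. [folklore]
-/

noncomputable section

open MeasureTheory ProbabilityTheory InformationTheory Real Finset Set
open scoped NNReal
open Literature.Probability.LatticeModels hiding configShift configShift_apply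
open Literature.MathematicalPhysics.QuantumLattice
open Literature.MathematicalPhysics.QuantumFieldTheory (haarProbability)

namespace Summit.Ventures.YMGap.RobustBall

namespace BoundaryFreeEnergy

variable {d N : ℕ}

/-- **Deep and shallow plaquettes, every-`N` profile**: for `0 ≤ r ≤ 1`, `0 ≤ C`, any cap `A` and any depths `D`,
`Σ_{p∈T} min A (C·r^{⌊D_p⌋}) ≤ C·r^K·#T + A·#{p ∈ T : D_p < K}`. [folklore] -/
theorem surface_sum_le_of_depth_dim {r C A : ℝ} (hr0 : 0 ≤ r) (hr1 : r ≤ 1) (hC : 0 ≤ C) (T : Finset (ZdPlaquette d))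
    (D : ZdPlaquette d → ℝ) (K : ℕ) :
    ∑ p ∈ T, min A (C * r ^ ⌊D p⌋₊) ≤ C * r ^ K * T.card + A * (T.filter fun p => D p < K).card := by
  classical
  rw [← Finset.sum_filter_add_sum_filter_not T (fun p => D p < K)]
  have hsh : ∑ p ∈ T.filter (fun p => D p < K), min A (C * r ^ ⌊D p⌋₊) ≤ A * (T.filter fun p => D p < K).card := by
    refine (Finset.sum_le_card_nsmul _ _ A fun p _ => min_le_left _ _).trans ?_
    rw [nsmul_eq_mul, mul_comm]
  have hdp : ∑ p ∈ T.filter (fun p => ¬D p < K), min A (C * r ^ ⌊D p⌋₊) ≤ C * r ^ K * T.card := by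
    refine (Finset.sum_le_card_nsmul _ _ (C * r ^ K) fun p hp => ?_).trans ?_
    · have h1 : (K : ℝ) ≤ D p := not_lt.1 (Finset.mem_filter.1 hp).2
      have hpK : K ≤ ⌊D p⌋₊ := Nat.le_floor h1
      exact (min_le_right _ _).trans (mul_le_mul_of_nonneg_left (pow_le_pow_of_le_one hr0 hr1 hpK) hC)
    · rw [nsmul_eq_mul]
      have hc : ((T.filter (fun p => ¬D p < K)).card : ℝ) ≤ T.card := by exact_mod_cast Finset.card_filter_le _ _
      have : 0 ≤ C * r ^ K := by positivity
      nlinarith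
  linarith

section Window

variable [NeZero d] (hd : 2 ≤ d) (hN : 2 ≤ N) {β ρ : ℝ} (hβ0 : 0 ≤ β) (hβ : β ≤ 1 / (12 * ((d : ℝ) - 1))) (hβ' : β < 1 / (8 * (d : ℝ)))
  (hρ : 6 * ((d : ℝ) - 1) * β / (1 / 2 - β * (2 * ((d : ℝ) - 1))) ≤ ρ) (hρ1 : ρ < 1)
include hd hN hβ0 hβ hβ' hρ hρ1

omit [NeZero d] in
/-- ★★ **FREE ENERGY PER PLAQUETTE, EVERY `N ≥ 2`, EVERY `d ≥ 2`, VAN HOVE FORM, ARBITRARY SHAPES**: for every finite `Λ` with `T(Λ) ≠ ∅`, EVERY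
boundary field `η`, depths `D` and budget `K`,
`|log Z_Λ(Nβ|η)/#T(Λ) − f(Nβ)/#planes(d)| ≤ Nβ·(32N⁴√N·max(ρ,½)^K + 2N·#{p ∈ T(Λ) : D_p < K}/#T(Λ))` — HYPOTHESIS-FREE. [folklore] -/
theorem suN_abs_log_normaliser_div_sub_le_of_depth_dim [DecidableEq (ZdEdge d)] (Λ : Finset (ZdEdge d))
    (hT : (plaquettesTouching Λ).Nonempty) (η : LGConfig d (SUN N)) (D : ZdPlaquette d → ℝ)
    (hD : ∀ p ∈ plaquettesTouching Λ, ∀ y ∈ plaquetteEdges p, ∀ z, z ∉ Λ → D p ≤ ‖y.1 - z.1‖) (K : ℕ) :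
    |Real.log (∫ ζ, Real.exp (-(N * β) * wilsonBoundaryAction (fundamentalRep (Fin N)) Λ (glueWith Λ ζ η))
          ∂(Measure.pi fun _ : ↥Λ => haarProbability (SUN N))) / (plaquettesTouching Λ).card -
        freeEnergyDensity d (fundamentalRep (Fin N)) (N * β) / (Fintype.card {q : Fin d × Fin d // q.1 < q.2} : ℝ)| ≤
      N * β * (32 * (N : ℝ) ^ 4 * Real.sqrt N * (max ρ (1 / 2)) ^ K +
        2 * (N : ℝ) * ((plaquettesTouching Λ).filter fun p => D p < K).card / (plaquettesTouching Λ).card) := by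
  classical
  set T := plaquettesTouching Λ with hTdef
  set r : ℝ := max ρ (1 / 2) with hr
  set C : ℝ := 32 * (N : ℝ) ^ 4 * Real.sqrt N with hC
  set np : ℝ := (Fintype.card {q : Fin d × Fin d // q.1 < q.2} : ℝ) with hnp
  have hC0 : 0 ≤ C := by positivity
  have hr0 : 0 ≤ r := le_max_of_le_right (by norm_num)
  have hr1 : r ≤ 1 := max_le hρ1.le (by norm_num)
  have hN0 : (0 : ℝ) ≤ N := by positivity
  have hNβ0 : 0 ≤ (N : ℝ) * β := by positivity
  have hTpos : (0 : ℝ) < (T.card : ℝ) := by exact_mod_cast Finset.card_pos.2 hT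
  have hmain := suN_abs_log_normaliser_sub_freeEnergy_le hd hN hβ0 hβ hβ' hρ hρ1 Λ η D hD
  have hS := surface_sum_le_of_depth_dim hr0 hr1 hC0 (A := 2 * (N : ℝ)) T D K
  rw [show Real.log (∫ ζ, Real.exp (-(N * β) * wilsonBoundaryAction (fundamentalRep (Fin N)) Λ (glueWith Λ ζ η))
          ∂(Measure.pi fun _ : ↥Λ => haarProbability (SUN N))) / (T.card : ℝ) - freeEnergyDensity d (fundamentalRep (Fin N)) (N * β) / np =
      (Real.log (∫ ζ, Real.exp (-(N * β) * wilsonBoundaryAction (fundamentalRep (Fin N)) Λ (glueWith Λ ζ η))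
          ∂(Measure.pi fun _ : ↥Λ => haarProbability (SUN N))) - (T.card : ℝ) / np * freeEnergyDensity d (fundamentalRep (Fin N)) (N * β)) /
        (T.card : ℝ) by field_simp, abs_div, abs_of_pos hTpos, div_le_iff₀ hTpos]
  refine hmain.trans ?_
  have e : N * β * (C * r ^ K + 2 * (N : ℝ) * ((T.filter fun p => D p < K).card : ℝ) / T.card) * T.card =
      N * β * (C * r ^ K * T.card + 2 * N * (T.filter fun p => D p < K).card) := by
    field_simp
  rw [e]
  exact mul_le_mul_of_nonneg_left hS hNβ0

/-- ★★ **MEAN ENERGY PER PLAQUETTE, EVERY `N ≥ 2`, EVERY `d ≥ 2`, VAN HOVE FORM, ARBITRARY SHAPES** (`μ` THE DLR state at `Nβ`, `u = μ(Re tr U_{p₀})`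
— all plaquette means agree by translation invariance and axis symmetry): for every finite `Λ` with `T(Λ) ≠ ∅`, EVERY `η`, depths `D`, budget `K`,
`|γ_Λ^{Nβ}(S_Λ|η)/#T(Λ) − (N − u)| ≤ 32N⁴√N·max(ρ,½)^K + 2N·#{p ∈ T(Λ) : D_p < K}/#T(Λ)` — HYPOTHESIS-FREE. [folklore] -/
theorem suN_abs_kernel_energy_div_sub_le_of_depth_dim [DecidableEq (ZdEdge d)]
    {μ : Measure (LGConfig d (SUN N))} (hμ : μ ∈ ymGibbsMeasures (d := d) (fundamentalRep (Fin N)) (N * β)) (Λ : Finset (ZdEdge d))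
    (hT : (plaquettesTouching Λ).Nonempty) (η : LGConfig d (SUN N)) (D : ZdPlaquette d → ℝ)
    (hD : ∀ p ∈ plaquettesTouching Λ, ∀ y ∈ plaquetteEdges p, ∀ z, z ∉ Λ → D p ≤ ‖y.1 - z.1‖) (K : ℕ) :
    |(∫ U, wilsonBoundaryAction (fundamentalRep (Fin N)) Λ U ∂(ymSpecification (d := d) (fundamentalRep (Fin N)) (N * β) Λ η)) /
          (plaquettesTouching Λ).card -
        ((N : ℝ) - ∫ U, plaquetteObs (fundamentalRep (Fin N)) 0 0 1 U ∂μ)| ≤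
      32 * (N : ℝ) ^ 4 * Real.sqrt N * (max ρ (1 / 2)) ^ K +
        2 * (N : ℝ) * ((plaquettesTouching Λ).filter fun p => D p < K).card / (plaquettesTouching Λ).card := by
  classical
  have hρc : Continuous (fundamentalRep (Fin N)) := continuous_fundamentalRep (Fin N)
  set T := plaquettesTouching Λ with hTdef
  set r : ℝ := max ρ (1 / 2) with hr
  set C : ℝ := 32 * (N : ℝ) ^ 4 * Real.sqrt N with hC
  have hC0 : 0 ≤ C := by positivity
  have hr0 : 0 ≤ r := le_max_of_le_right (by norm_num)
  have hr1 : r ≤ 1 := max_le hρ1.le (by norm_num)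
  have hTpos : (0 : ℝ) < (T.card : ℝ) := by exact_mod_cast Finset.card_pos.2 hT
  have hd2 : (2 : ℝ) ≤ d := by exact_mod_cast hd
  -- the 't Hooft window sits inside the single-link door `2(d−1)|β| < 1/2`
  have hb : |β| * (2 * ((d : ℝ) - 1)) < 1 / 2 := by
    rw [abs_of_nonneg hβ0]
    have h1 : β * (12 * ((d : ℝ) - 1)) ≤ 1 := by rwa [le_div_iff₀ (by nlinarith)] at hβ
    nlinarith
  have hρ' : 6 * ((d : ℝ) - 1) * |β| / (1 / 2 - |β| * (2 * ((d : ℝ) - 1))) ≤ ρ := by rwa [abs_of_nonneg hβ0]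
  -- the one state is axis symmetric: all plaquette means agree
  have hβs : |β| < HessianSharp.sharpThresholdSU d := by
    rw [abs_of_nonneg hβ0]; exact hβ'
  obtain ⟨ν, h1, h2, -, -⟩ := suN_wilson_oneState_symmetric_sharp hd hN hβs
  have hμν : μ = ν := by rw [h1] at hμ; exact Set.mem_singleton_iff.1 hμ
  have hνL : ν ∈ infiniteVolumeLimitPoints (d := d) (fundamentalRep (Fin N)) (N * β) := by rw [h2]; exact Set.mem_singleton _
  have hplane : ∀ p ∈ T, ∫ U, plaquetteObs (fundamentalRep (Fin N)) p.1 p.2.1.1 p.2.1.2 U ∂μ =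
      ∫ U, plaquetteObs (fundamentalRep (Fin N)) 0 0 1 U ∂μ := fun p _ => by
    rw [hμν]; exact PlaquettePositivity.integral_plaquetteObs_eq (fundamentalRep (Fin N)) hρc hd hνL p.1 (ne_of_lt p.2.2)
  -- the energy theorem: kernel energy = Σ (N − γ(W_p)), each plaquette within the boundary error of μ(W_p)
  have hmain : |(∫ U, wilsonBoundaryAction (fundamentalRep (Fin N)) Λ U ∂(ymSpecification (d := d) (fundamentalRep (Fin N)) (N * β) Λ η)) -
      ∑ p ∈ T, ((N : ℝ) - ∫ U, plaquetteObs (fundamentalRep (Fin N)) p.1 p.2.1.1 p.2.1.2 U ∂μ)| ≤ ∑ p ∈ T, min (2 * (N : ℝ)) (C * r ^ ⌊D p⌋₊) := by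
    rw [suN_integral_wilsonBoundaryAction_kernel, ← Finset.sum_sub_distrib]
    refine (Finset.abs_sum_le_sum_abs _ _).trans (Finset.sum_le_sum fun p hp => ?_)
    rw [show ∀ x y : ℝ, ((N : ℝ) - x) - (N - y) = -(x - y) from fun x y => by ring, abs_neg]
    exact suN_abs_kernel_plaquette_sub_le (by omega) hN hb hρ' hρ1 hμ Λ η p (hD p hp)
  have hsum : ∑ p ∈ T, ((N : ℝ) - ∫ U, plaquetteObs (fundamentalRep (Fin N)) p.1 p.2.1.1 p.2.1.2 U ∂μ) =
      (T.card : ℝ) * ((N : ℝ) - ∫ U, plaquetteObs (fundamentalRep (Fin N)) 0 0 1 U ∂μ) := by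
    rw [Finset.sum_congr rfl fun p hp => by rw [hplane p hp], Finset.sum_const, nsmul_eq_mul]
  rw [hsum] at hmain
  have hS := surface_sum_le_of_depth_dim hr0 hr1 hC0 (A := 2 * (N : ℝ)) T D K
  set E := ∫ U, wilsonBoundaryAction (fundamentalRep (Fin N)) Λ U ∂(ymSpecification (d := d) (fundamentalRep (Fin N)) (N * β) Λ η) with hE
  set u := ∫ U, plaquetteObs (fundamentalRep (Fin N)) 0 0 1 U ∂μ with hu
  have key : ∀ (x t c : ℝ), 0 < t → x / t - c = (x - t * c) / t := fun x t c ht => by field_simp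
  rw [key E (T.card : ℝ) ((N : ℝ) - u) hTpos, abs_div, abs_of_pos hTpos, div_le_iff₀ hTpos]
  refine hmain.trans ?_
  have e : (C * r ^ K + 2 * (N : ℝ) * ((T.filter fun p => D p < K).card : ℝ) / T.card) * T.card =
      C * r ^ K * T.card + 2 * N * (T.filter fun p => D p < K).card := by
    field_simp
  rw [e]
  exact hS

/-- ★★ **ENTROPY PER PLAQUETTE, EVERY `N ≥ 2`, EVERY `d ≥ 2`, VAN HOVE FORM, ARBITRARY SHAPES**: with `u = μ(Re tr U_{p₀})` as above,
`|KL(π_Λ^{Nβ,η} ‖ Haar_Λ)/#T(Λ) − (−Nβ(N − u) − f(Nβ)/#planes(d))| ≤ 2Nβ·(32N⁴√N·max(ρ,½)^K + 2N·#{p ∈ T(Λ) : D_p < K}/#T(Λ))` — HYPOTHESIS-FREE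
(the entropy identity `KL = −Nβ·γ_Λ(S_Λ|η) − log Z_Λ` and the two theorems above). [folklore] -/
theorem suN_abs_klDiv_div_sub_le_of_depth_dim [DecidableEq (ZdEdge d)]
    {μ : Measure (LGConfig d (SUN N))} (hμ : μ ∈ ymGibbsMeasures (d := d) (fundamentalRep (Fin N)) (N * β)) (Λ : Finset (ZdEdge d))
    (hT : (plaquettesTouching Λ).Nonempty) (η : LGConfig d (SUN N)) (D : ZdPlaquette d → ℝ)
    (hD : ∀ p ∈ plaquettesTouching Λ, ∀ y ∈ plaquetteEdges p, ∀ z, z ∉ Λ → D p ≤ ‖y.1 - z.1‖) (K : ℕ) :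
    |(klDiv ((Measure.pi fun _ : ↥Λ => haarProbability (SUN N)).tilted
          (fun ζ => -(N * β) * wilsonBoundaryAction (fundamentalRep (Fin N)) Λ (glueWith Λ ζ η)))
        (Measure.pi fun _ : ↥Λ => haarProbability (SUN N))).toReal / (plaquettesTouching Λ).card -
        (-(N * β) * ((N : ℝ) - ∫ U, plaquetteObs (fundamentalRep (Fin N)) 0 0 1 U ∂μ) -
          freeEnergyDensity d (fundamentalRep (Fin N)) (N * β) / (Fintype.card {q : Fin d × Fin d // q.1 < q.2} : ℝ))| ≤
      2 * (N * β) * (32 * (N : ℝ) ^ 4 * Real.sqrt N * (max ρ (1 / 2)) ^ K +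
        2 * (N : ℝ) * ((plaquettesTouching Λ).filter fun p => D p < K).card / (plaquettesTouching Λ).card) := by
  haveI : SecondCountableTopology (Matrix.specialUnitaryGroup (Fin N) ℂ) :=
    haveI : SecondCountableTopology (Matrix (Fin N) (Fin N) ℂ) := inferInstanceAs (SecondCountableTopology (Fin N → Fin N → ℂ))
    Topology.IsEmbedding.subtypeVal.secondCountableTopology
  have hρc : Continuous (fundamentalRep (Fin N)) := continuous_fundamentalRep (Fin N)
  have hNβ0 : 0 ≤ (N : ℝ) * β := by positivity
  have hTpos : (0 : ℝ) < ((plaquettesTouching Λ).card : ℝ) := by exact_mod_cast Finset.card_pos.2 hT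
  have e1 := suN_abs_log_normaliser_div_sub_le_of_depth_dim hd hN hβ0 hβ hβ' hρ hρ1 Λ hT η D hD K
  have e2 := suN_abs_kernel_energy_div_sub_le_of_depth_dim hd hN hβ0 hβ hβ' hρ hρ1 hμ Λ hT η D hD K
  rw [toReal_klDiv_inner_law_haar_eq (fundamentalRep (Fin N)) hρc (N * β) Λ η]
  set LZ := Real.log (∫ ζ, Real.exp (-(N * β) * wilsonBoundaryAction (fundamentalRep (Fin N)) Λ (glueWith Λ ζ η))
    ∂(Measure.pi fun _ : ↥Λ => haarProbability (SUN N))) with hLZ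
  set E := ∫ U, wilsonBoundaryAction (fundamentalRep (Fin N)) Λ U ∂(ymSpecification (d := d) (fundamentalRep (Fin N)) (N * β) Λ η) with hE
  set T : ℝ := ((plaquettesTouching Λ).card : ℝ) with hTdef
  set u := ∫ U, plaquetteObs (fundamentalRep (Fin N)) 0 0 1 U ∂μ with hu
  set f := freeEnergyDensity d (fundamentalRep (Fin N)) (N * β) with hf
  set np : ℝ := (Fintype.card {q : Fin d × Fin d // q.1 < q.2} : ℝ) with hnp
  set S : ℝ := 32 * (N : ℝ) ^ 4 * Real.sqrt N * (max ρ (1 / 2)) ^ K +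
    2 * (N : ℝ) * ((plaquettesTouching Λ).filter fun p => D p < K).card / T with hS
  have key : ∀ (c x l t n v g q : ℝ), t ≠ 0 → (-c * x - l) / t - (-c * (n - v) - g / q) = -c * (x / t - (n - v)) - (l / t - g / q) :=
    fun c x l t n v g q ht => by field_simp; ring
  have eq : (-(N * β) * E - LZ) / T - (-(N * β) * (N - u) - f / np) = -(N * β) * (E / T - (N - u)) - (LZ / T - f / np) :=
    key _ _ _ _ _ _ _ _ hTpos.ne'
  rw [eq]
  have hbE : |(N : ℝ) * β * (E / T - (N - u))| ≤ N * β * S := by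
    rw [abs_mul, abs_of_nonneg hNβ0]; exact mul_le_mul_of_nonneg_left e2 hNβ0
  calc |-(N * β) * (E / T - (N - u)) - (LZ / T - f / np)|
      ≤ |-(N * β) * (E / T - (N - u))| + |LZ / T - f / np| := abs_sub _ _
    _ ≤ N * β * S + N * β * S := by rw [neg_mul, abs_neg]; exact add_le_add hbE e1
    _ = 2 * (N * β) * S := by ring

/-! ### The thermodynamic limit along van Hove sequences, every `N ≥ 2`, every `d ≥ 2`, uniformly in the boundary field -/

omit [NeZero d] hd hN hβ0 hβ hβ' hρ hρ1 in
/-- **Choosing the budget and the index (geometric profile)**: if `0 ≤ r < 1` and the shallow fractions `s_n(K)` tend to `0` for every budget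
`K`, then for every `ε > 0` there are `K` and `n₀` with `a·(C·r^K + A·s_n(K)) ≤ ε` for all `n ≥ n₀`. [folklore] -/
theorem exists_budget_of_vanHove_pow {r : ℝ} (hr0 : 0 ≤ r) (hr1 : r < 1) (a C A : ℝ) (s : ℕ → ℕ → ℝ)
    (hs : ∀ K : ℕ, Filter.Tendsto (fun n => s n K) Filter.atTop (nhds 0)) {ε : ℝ} (hε : 0 < ε) :
    ∃ K n₀ : ℕ, ∀ n ≥ n₀, a * (C * r ^ K + A * s n K) ≤ ε := by
  have h1 : Filter.Tendsto (fun K : ℕ => a * C * r ^ K) Filter.atTop (nhds 0) := by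
    simpa using (tendsto_pow_atTop_nhds_zero_of_lt_one hr0 hr1).const_mul (a * C)
  obtain ⟨K, hK⟩ := (h1.eventually (eventually_le_nhds (show (0 : ℝ) < ε / 2 by linarith))).exists
  have h2 : Filter.Tendsto (fun n => a * (A * s n K)) Filter.atTop (nhds 0) := by simpa using ((hs K).const_mul A).const_mul a
  obtain ⟨n₀, hn₀⟩ := Filter.eventually_atTop.1 (h2.eventually (eventually_le_nhds (show (0 : ℝ) < ε / 2 by linarith)))
  refine ⟨K, n₀, fun n hn => ?_⟩
  have := hn₀ n hn
  nlinarith [hK, this]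

omit [NeZero d] in
/-- ★★ **THE FREE ENERGY PER PLAQUETTE CONVERGES ALONG EVERY VAN HOVE SEQUENCE, UNIFORMLY IN THE BOUNDARY FIELD, EVERY `N ≥ 2`, EVERY `d ≥ 2`**
(van Hove sequence with depth data: finite `Λ_n` with `T(Λ_n) ≠ ∅`, depths `D_{n,p} ≤ dist_∞(links of p, Λ_nᶜ)`, shallow fractions
`#{p ∈ T(Λ_n) : D_{n,p} < K}/#T(Λ_n) → 0` for every `K`): `∀ ε > 0, ∃ n₀, ∀ n ≥ n₀, ∀ η, |log Z_{Λ_n}(Nβ|η)/#T(Λ_n) − f(Nβ)/#planes(d)| ≤ ε` —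
HYPOTHESIS-FREE. [folklore] -/
theorem suN_log_normaliser_div_vanHove_uniform_dim [DecidableEq (ZdEdge d)] (Λ : ℕ → Finset (ZdEdge d))
    (hT : ∀ n, (plaquettesTouching (Λ n)).Nonempty) (D : ℕ → ZdPlaquette d → ℝ)
    (hD : ∀ n, ∀ p ∈ plaquettesTouching (Λ n), ∀ y ∈ plaquetteEdges p, ∀ z, z ∉ Λ n → D n p ≤ ‖y.1 - z.1‖)
    (hvH : ∀ K : ℕ, Filter.Tendsto (fun n => ((((plaquettesTouching (Λ n)).filter fun p => D n p < K).card : ℝ)) /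
      (plaquettesTouching (Λ n)).card) Filter.atTop (nhds 0)) :
    ∀ ε > 0, ∃ n₀ : ℕ, ∀ n ≥ n₀, ∀ η : LGConfig d (SUN N),
      |Real.log (∫ ζ, Real.exp (-(N * β) * wilsonBoundaryAction (fundamentalRep (Fin N)) (Λ n) (glueWith (Λ n) ζ η))
            ∂(Measure.pi fun _ : ↥(Λ n) => haarProbability (SUN N))) / (plaquettesTouching (Λ n)).card -
          freeEnergyDensity d (fundamentalRep (Fin N)) (N * β) / (Fintype.card {q : Fin d × Fin d // q.1 < q.2} : ℝ)| ≤ ε := by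
  intro ε hε
  have hr0 : (0 : ℝ) ≤ max ρ (1 / 2) := le_max_of_le_right (by norm_num)
  have hr1 : max ρ (1 / 2) < 1 := max_lt hρ1 (by norm_num)
  obtain ⟨K, n₀, hKn⟩ := exists_budget_of_vanHove_pow hr0 hr1 (N * β) (32 * (N : ℝ) ^ 4 * Real.sqrt N) (2 * (N : ℝ))
    (fun n K => ((((plaquettesTouching (Λ n)).filter fun p => D n p < K).card : ℝ)) / (plaquettesTouching (Λ n)).card) hvH hε
  refine ⟨n₀, fun n hn η => ?_⟩
  have h' := hKn n hn
  rw [← mul_div_assoc] at h'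
  exact (suN_abs_log_normaliser_div_sub_le_of_depth_dim hd hN hβ0 hβ hβ' hρ hρ1 (Λ n) (hT n) η (D n) (hD n) K).trans h'

/-- ★★ **THE MEAN ENERGY PER PLAQUETTE CONVERGES ALONG EVERY VAN HOVE SEQUENCE, UNIFORMLY IN THE BOUNDARY FIELD, EVERY `N ≥ 2`, EVERY
`d ≥ 2`**, to `N − u` (`u = μ(Re tr U_{p₀})`, `μ` THE DLR state at `Nβ`) — HYPOTHESIS-FREE. [folklore] -/
theorem suN_kernel_energy_div_vanHove_uniform_dim [DecidableEq (ZdEdge d)]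
    {μ : Measure (LGConfig d (SUN N))} (hμ : μ ∈ ymGibbsMeasures (d := d) (fundamentalRep (Fin N)) (N * β)) (Λ : ℕ → Finset (ZdEdge d))
    (hT : ∀ n, (plaquettesTouching (Λ n)).Nonempty) (D : ℕ → ZdPlaquette d → ℝ)
    (hD : ∀ n, ∀ p ∈ plaquettesTouching (Λ n), ∀ y ∈ plaquetteEdges p, ∀ z, z ∉ Λ n → D n p ≤ ‖y.1 - z.1‖)
    (hvH : ∀ K : ℕ, Filter.Tendsto (fun n => ((((plaquettesTouching (Λ n)).filter fun p => D n p < K).card : ℝ)) /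
      (plaquettesTouching (Λ n)).card) Filter.atTop (nhds 0)) :
    ∀ ε > 0, ∃ n₀ : ℕ, ∀ n ≥ n₀, ∀ η : LGConfig d (SUN N),
      |(∫ U, wilsonBoundaryAction (fundamentalRep (Fin N)) (Λ n) U ∂(ymSpecification (d := d) (fundamentalRep (Fin N)) (N * β) (Λ n) η)) /
            (plaquettesTouching (Λ n)).card -
          ((N : ℝ) - ∫ U, plaquetteObs (fundamentalRep (Fin N)) 0 0 1 U ∂μ)| ≤ ε := by
  intro ε hε
  have hr0 : (0 : ℝ) ≤ max ρ (1 / 2) := le_max_of_le_right (by norm_num)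
  have hr1 : max ρ (1 / 2) < 1 := max_lt hρ1 (by norm_num)
  obtain ⟨K, n₀, hKn⟩ := exists_budget_of_vanHove_pow hr0 hr1 1 (32 * (N : ℝ) ^ 4 * Real.sqrt N) (2 * (N : ℝ))
    (fun n K => ((((plaquettesTouching (Λ n)).filter fun p => D n p < K).card : ℝ)) / (plaquettesTouching (Λ n)).card) hvH hε
  refine ⟨n₀, fun n hn η => ?_⟩
  have h' := hKn n hn
  rw [one_mul, ← mul_div_assoc] at h'
  exact (suN_abs_kernel_energy_div_sub_le_of_depth_dim hd hN hβ0 hβ hβ' hρ hρ1 hμ (Λ n) (hT n) η (D n) (hD n) K).trans h'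

/-- ★★ **THE ENTROPY PER PLAQUETTE CONVERGES ALONG EVERY VAN HOVE SEQUENCE, UNIFORMLY IN THE BOUNDARY FIELD, EVERY `N ≥ 2`, EVERY `d ≥ 2`**:
`KL(π_{Λ_n}^{Nβ,η} ‖ Haar_{Λ_n})/#T(Λ_n) → −Nβ(N − u) − f(Nβ)/#planes(d)` uniformly in `η` — HYPOTHESIS-FREE. [folklore] -/
theorem suN_klDiv_div_vanHove_uniform_dim [DecidableEq (ZdEdge d)]
    {μ : Measure (LGConfig d (SUN N))} (hμ : μ ∈ ymGibbsMeasures (d := d) (fundamentalRep (Fin N)) (N * β)) (Λ : ℕ → Finset (ZdEdge d))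
    (hT : ∀ n, (plaquettesTouching (Λ n)).Nonempty) (D : ℕ → ZdPlaquette d → ℝ)
    (hD : ∀ n, ∀ p ∈ plaquettesTouching (Λ n), ∀ y ∈ plaquetteEdges p, ∀ z, z ∉ Λ n → D n p ≤ ‖y.1 - z.1‖)
    (hvH : ∀ K : ℕ, Filter.Tendsto (fun n => ((((plaquettesTouching (Λ n)).filter fun p => D n p < K).card : ℝ)) /
      (plaquettesTouching (Λ n)).card) Filter.atTop (nhds 0)) :
    ∀ ε > 0, ∃ n₀ : ℕ, ∀ n ≥ n₀, ∀ η : LGConfig d (SUN N),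
      |(klDiv ((Measure.pi fun _ : ↥(Λ n) => haarProbability (SUN N)).tilted
            (fun ζ => -(N * β) * wilsonBoundaryAction (fundamentalRep (Fin N)) (Λ n) (glueWith (Λ n) ζ η)))
          (Measure.pi fun _ : ↥(Λ n) => haarProbability (SUN N))).toReal / (plaquettesTouching (Λ n)).card -
          (-(N * β) * ((N : ℝ) - ∫ U, plaquetteObs (fundamentalRep (Fin N)) 0 0 1 U ∂μ) -
            freeEnergyDensity d (fundamentalRep (Fin N)) (N * β) / (Fintype.card {q : Fin d × Fin d // q.1 < q.2} : ℝ))| ≤ ε := by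
  intro ε hε
  have hr0 : (0 : ℝ) ≤ max ρ (1 / 2) := le_max_of_le_right (by norm_num)
  have hr1 : max ρ (1 / 2) < 1 := max_lt hρ1 (by norm_num)
  obtain ⟨K, n₀, hKn⟩ := exists_budget_of_vanHove_pow hr0 hr1 (2 * (N * β)) (32 * (N : ℝ) ^ 4 * Real.sqrt N) (2 * (N : ℝ))
    (fun n K => ((((plaquettesTouching (Λ n)).filter fun p => D n p < K).card : ℝ)) / (plaquettesTouching (Λ n)).card) hvH hε
  refine ⟨n₀, fun n hn η => ?_⟩
  have h' := hKn n hn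
  rw [← mul_div_assoc] at h'
  exact (suN_abs_klDiv_div_sub_le_of_depth_dim hd hN hβ0 hβ hβ' hρ hρ1 hμ (Λ n) (hT n) η (D n) (hD n) K).trans h'

end Window

end BoundaryFreeEnergy

end Summit.Ventures.YMGap.RobustBall

end
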